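import Literature.Analysis.Complex.HarmonicDipoleEstimate
import Mathlib.Analysis.SpecialFunctions.Integrals.PosLogEqCircleAverage
import HarnessLib

/-!
# The dipole estimate on an annulus with a logarithmic (non-zero flux) term allowed

Topic `Literature/Analysis/Complex` (PROOF-ONLY: no definition, no named fact; classical, [folklore]).
Sequel of `AnnulusHarmonicSchwarz` / `HarmonicDipoleEstimate` (the planar core of Lin (7.3.3.3)), for the
abc-iut cell's programme «UNIF-G1P» Tier 2 (GAP G-L4t8g7-2, parabolic case).  I-Hsiung Lin, *Classical
Complex Analysis: A Geometric Approach*, vol. 2 (2011), §7.3.3 (7.3.3.3), proof, Step 1 (*5)–(*12), and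
H. M. Farkas, I. Kra, *Riemann Surfaces* (2nd ed. 1992), IV.3.16 (3.16.1)–(3.16.5).

In print the estimate (*5)/(3.16.1) for the exterior solutions `u_ρ` is obtained AFTER the zero-flux lemma
((7.3.3.4) / IV.3.15), which makes the constant Fourier coefficient `α₀(ρ)` vanish.  For a general harmonic
`u` on the annulus `ρ < ‖z − c‖ < R` one has `⨍_{‖z−c‖=t} u = α + β log t`; this file proves the SAME
estimates with the additive error `|⨍_{‖z−c‖=R} u|` (`= |β| log (R/ρ)` when `u` has the dipole datum,
whose means vanish, on the inner circle) — so that they can be used for functions whose flux is merely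
small, or zero in the limit:

* `abs_circleAverage_le_of_abs_le` — `|⨍ f| ≤ K` if `|f| ≤ K` on the circle;
* `abs_le_abs_circleAverage_add_of_harmonicOnNhd_annulus` — the annulus Schwarz bound WITHOUT the zero-mean
  hypothesis: `w` continuous on `ρ ≤ ‖z − c‖ ≤ R`, harmonic inside, `w = 0` on the inner circle, `|w| ≤ K`
  on the outer one ⟹ `|w(z)| ≤ |⨍_{‖z−c‖=R} w| + 8K‖z − c‖/R` (subtract `a·log(‖z−c‖/ρ)/log(R/ρ)`,
  `a = ⨍ w`, which is harmonic, vanishes on the inner circle, is `≤ 1`, and has mean `1` on the outer one —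
  Mathlib's `circleAverage_log_norm_sub_const_of_mem_closedBall` — then apply the zero-mean bound);
* `abs_sub_re_mul_inv_le_of_harmonicOnNhd_annulus` — Lin's (*5)/(*12) for the datum `Re (w/(z − c))` of an
  ARBITRARY direction `w`, `‖w‖ ≤ 1`, with the additive error `|⨍_{‖z−c‖=R} u|`;
* `abs_sub_re_mul_inv_le_uniform_of_abs_circleAverage_le` — the bootstrap (Lin's `C(r)`, FK (3.16.5)) in
  the same generality: if the outer bound `M` is attained by `|u|` on a circle `‖z − c‖ = r`, `ρ ≤ r`,
  `16 r ≤ R`, then `|u(z) − Re (w/(z − c))| ≤ A + 16(r⁻¹ + A + R⁻¹)‖z − c‖/R` for any `A ≥ |⨍_{‖z−c‖=R} u|`,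
  free of `ρ` and `M`;
* `exists_harmonicOnNhd_eq_sub_re_mul_inv` — removability of `u − Re (w/(z − c))` at `c` from a linear
  bound (the tree's removable-singularity theorem), for an arbitrary direction `w`.

Nothing here bears on [IUTchIII] Cor. 3.12: classical mathematics.

## References
* [Lin2011ClassicalComplexAnalysisII] I-Hsiung Lin, *Classical Complex Analysis: A Geometric Approach*,
  vol. 2 (2011), §7.3.3 (7.3.3.3), proof, Step 1, (*5)–(*12); Step 3.
* [FarkasKra1992] H. M. Farkas, I. Kra, *Riemann Surfaces*, 2nd ed. (1992), IV.3.16, (3.16.1)–(3.16.5).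
-/

noncomputable section

open scoped Topology

namespace Literature.Analysis.Complex

open _root_.Complex Metric Set Filter Real InnerProductSpace

variable {c : ℂ} {R : ℝ}

/-! ### §0 Two elementary facts about circle means -/

/-- `|⨍_{‖z−c‖=R} f| ≤ K` when `f` is continuous on the circle with `|f| ≤ K` there (the trivial bound on a
Fourier coefficient used in FK's (3.16.3): `|α_k| ≤ 2(m(ρ) + m)`). [cite: FarkasKra1992, IV.3.16 (3.16.3)]
[folklore] -/
theorem abs_circleAverage_le_of_abs_le {f : ℂ → ℝ} {K : ℝ} (hf : ContinuousOn f (sphere c |R|))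
    (hK : ∀ z ∈ sphere c |R|, |f z| ≤ K) : |circleAverage f c R| ≤ K := by
  refine abs_circleAverage_le_circleAverage_abs.trans ?_
  refine circleAverage_mono_on_of_le_circle ?_ fun z hz => ?_
  · have h := (hf.norm).circleIntegrable'
    refine h.congr_codiscreteWithin ?_
    -- `‖f z‖ = |f z|` everywhere
    exact Filter.Eventually.of_forall fun z => by simp only [Pi.abs_apply, Real.norm_eq_abs]
  · rw [Pi.abs_apply]; exact hK z hz

/-- The mean of `log ‖z − c‖` over the circle `‖z − c‖ = R` is `log R` (Mathlib's Jensen-type identity;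
the constant Fourier coefficient of the flux term `log |z|` in FK's (3.16.2)). [cite: FarkasKra1992, IV.3.16 (3.16.2)]
[folklore] -/
theorem circleAverage_log_norm_sub_center (c : ℂ) (R : ℝ) :
    circleAverage (fun z => Real.log ‖z - c‖) c R = Real.log R :=
  circleAverage_log_norm_sub_const_of_mem_closedBall (a := c) (c := c) (R := R)
    (mem_closedBall_self (abs_nonneg R))

/-! ### §1 The annulus Schwarz bound without the zero-mean hypothesis -/

/-- **Annulus Schwarz bound with a logarithmic term allowed.**  Let `w` be continuous on the closed
annulus `ρ ≤ ‖z − c‖ ≤ R` (`0 < ρ < R`), harmonic inside, `w = 0` on the inner circle and `|w| ≤ K` on the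
outer one.  Then `|w(z)| ≤ |⨍_{‖z−c‖=R} w| + 8K‖z − c‖/R` on the closed annulus.  (With
`a := ⨍_{‖z−c‖=R} w`, the function `w − a·log(‖z−c‖/ρ)/log(R/ρ)` has zero mean on the outer circle and
the tree's `abs_le_mul_norm_of_harmonicOnNhd_annulus` applies to it; in Lin's notation `a = α₀(ρ)/2`, the
flux term, which (7.3.3.4) would kill.) [cite: Lin2011ClassicalComplexAnalysisII, §7.3.3 (7.3.3.3) proof, Step 1 (*9)–(*12)]
[folklore] -/
theorem abs_le_abs_circleAverage_add_of_harmonicOnNhd_annulus {w : ℂ → ℝ} {ρ K : ℝ} (hρ : 0 < ρ)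
    (hρR : ρ < R) (hw : HarmonicOnNhd w (ball c R \ closedBall c ρ))
    (hwc : ContinuousOn w (closedBall c R \ ball c ρ)) (h0 : ∀ z ∈ sphere c ρ, w z = 0)
    (hK : ∀ z ∈ sphere c R, |w z| ≤ K) :
    ∀ z ∈ closedBall c R \ ball c ρ, |w z| ≤ |circleAverage w c R| + 8 * K * ‖z - c‖ / R := by
  have hR : 0 < R := hρ.trans hρR
  have hlog : 0 < Real.log (R / ρ) := Real.log_pos ((one_lt_div hρ).2 hρR)
  set a : ℝ := circleAverage w c R with ha
  -- the outer circle lies in the closed annulus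
  have hSA : sphere c R ⊆ closedBall c R \ ball c ρ := fun z hz =>
    ⟨sphere_subset_closedBall hz, fun h => by
      rw [mem_ball] at h; rw [mem_sphere] at hz; rw [hz] at h; exact (lt_irrefl _) (h.trans hρR)⟩
  have haK : |a| ≤ K := by
    refine abs_circleAverage_le_of_abs_le (by rw [abs_of_pos hR]; exact hwc.mono hSA) ?_
    rw [abs_of_pos hR]; exact hK
  have hK0 : 0 ≤ K := (abs_nonneg a).trans haK
  -- the logarithmic profile `ℓ`
  set ℓ : ℂ → ℝ := fun z => Real.log (‖z - c‖ / ρ) / Real.log (R / ρ) with hℓ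
  have hℓ_harm : HarmonicOnNhd ℓ ({c}ᶜ : Set ℂ) := by
    intro z hz
    have hzc : z - c ≠ 0 := sub_ne_zero.2 hz
    have h1 : HarmonicAt (fun z : ℂ => Real.log ‖z - c‖) z :=
      (analyticAt_id.sub analyticAt_const).harmonicAt_log_norm hzc
    have h2 : HarmonicAt (fun z : ℂ => Real.log ‖z - c‖ - Real.log ρ) z := by
      have := h1.sub (harmonicAt_const (Real.log ρ))
      exact this
    have h3 : HarmonicAt ((Real.log (R / ρ))⁻¹ • fun z : ℂ => Real.log ‖z - c‖ - Real.log ρ) z :=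
      h2.const_smul
    refine (harmonicAt_congr_nhds ?_).2 h3
    filter_upwards [isOpen_compl_singleton.mem_nhds hz] with y hy
    have hyc : 0 < ‖y - c‖ := norm_pos_iff.2 (sub_ne_zero.2 hy)
    simp only [hℓ, Pi.smul_apply, smul_eq_mul]
    rw [Real.log_div hyc.ne' hρ.ne', div_eq_inv_mul]
  have hAc : closedBall c R \ ball c ρ ⊆ ({c}ᶜ : Set ℂ) := by
    intro z hz hzc
    rw [mem_singleton_iff] at hzc; subst hzc
    exact hz.2 (mem_ball_self hρ)
  have hUc : ball c R \ closedBall c ρ ⊆ ({c}ᶜ : Set ℂ) := fun z hz =>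
    hAc ⟨ball_subset_closedBall hz.1, fun h => hz.2 (ball_subset_closedBall h)⟩
  have hℓ_cont : ContinuousOn ℓ ({c}ᶜ : Set ℂ) := hℓ_harm.continuousOn
  have hℓ_inner : ∀ z ∈ sphere c ρ, ℓ z = 0 := by
    intro z hz
    rw [mem_sphere, dist_eq_norm] at hz
    simp only [hℓ, hz, div_self hρ.ne', Real.log_one, zero_div]
  have hℓ_outer : ∀ z ∈ sphere c R, ℓ z = 1 := by
    intro z hz
    rw [mem_sphere, dist_eq_norm] at hz
    simp only [hℓ, hz, div_self hlog.ne']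
  have hℓ_bounds : ∀ z ∈ closedBall c R \ ball c ρ, 0 ≤ ℓ z ∧ ℓ z ≤ 1 := by
    intro z hz
    have hzρ : ρ ≤ ‖z - c‖ := by
      have := hz.2; rw [mem_ball, dist_eq_norm, not_lt] at this; exact this
    have hzR : ‖z - c‖ ≤ R := by
      have := hz.1; rw [mem_closedBall, dist_eq_norm] at this; exact this
    have hzpos : 0 < ‖z - c‖ := hρ.trans_le hzρ
    have hnum0 : 0 ≤ Real.log (‖z - c‖ / ρ) := Real.log_nonneg ((one_le_div hρ).2 hzρ)
    have hnum1 : Real.log (‖z - c‖ / ρ) ≤ Real.log (R / ρ) :=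
      Real.log_le_log (div_pos hzpos hρ) (div_le_div_of_nonneg_right hzR hρ.le)
    refine ⟨div_nonneg hnum0 hlog.le, ?_⟩
    rw [hℓ]; exact (div_le_one hlog).2 hnum1
  have hℓ_avg : circleAverage ℓ c R = 1 := by
    have h1 : circleAverage (fun z : ℂ => Real.log ‖z - c‖) c R = Real.log R :=
      circleAverage_log_norm_sub_center c R
    -- on the circle (where `z ≠ c`) `ℓ` is an affine function of `log ‖z − c‖`
    have hrw : circleAverage ℓ c R =
        circleAverage (fun z => (Real.log (R / ρ))⁻¹ • (Real.log ‖z - c‖ - Real.log ρ)) c R := by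
      refine circleAverage_congr_sphere fun z hz => ?_
      rw [abs_of_pos hR, mem_sphere, dist_eq_norm] at hz
      have hzc : 0 < ‖z - c‖ := by rw [hz]; exact hR
      simp only [hℓ, smul_eq_mul]
      rw [Real.log_div hzc.ne' hρ.ne', div_eq_inv_mul]
    rw [hrw, circleAverage_fun_smul, circleAverage_fun_sub (circleIntegrable_log_norm_sub_const R)
      (circleIntegrable_const _ _ _), h1, circleAverage_const, smul_eq_mul,
      ← Real.log_div hR.ne' hρ.ne', inv_mul_cancel₀ hlog.ne']
  -- the corrected function
  set w' : ℂ → ℝ := fun z => w z - a * ℓ z with hw'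
  have hw'h : HarmonicOnNhd w' (ball c R \ closedBall c ρ) := by
    have : HarmonicOnNhd (fun z => a * ℓ z) (ball c R \ closedBall c ρ) := by
      have h := (hℓ_harm.mono hUc).const_smul (c := a)
      exact h
    exact hw.sub this
  have hw'c : ContinuousOn w' (closedBall c R \ ball c ρ) :=
    hwc.sub (continuousOn_const.mul (hℓ_cont.mono hAc))
  have hw'0 : ∀ z ∈ sphere c ρ, w' z = 0 := fun z hz => by
    simp only [hw', h0 z hz, hℓ_inner z hz, mul_zero, sub_zero]
  have hw'K : ∀ z ∈ sphere c R, |w' z| ≤ 2 * K := by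
    intro z hz
    simp only [hw', hℓ_outer z hz, mul_one]
    calc |w z - a| ≤ |w z| + |a| := abs_sub _ _
      _ ≤ K + K := add_le_add (hK z hz) haK
      _ = 2 * K := by ring
  have hw'avg : circleAverage w' c R = 0 := by
    have hi1 : CircleIntegrable w c R := (hwc.mono hSA).circleIntegrable hR.le
    have hi2 : CircleIntegrable (fun z => a * ℓ z) c R :=
      ((continuousOn_const.mul (hℓ_cont.mono hAc)).mono hSA).circleIntegrable hR.le
    have h2 : circleAverage (fun z => a * ℓ z) c R = a := by
      have := circleAverage_fun_smul (a := a) (f := ℓ) (c := c) (R := R)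
      simp only [smul_eq_mul] at this
      rw [this, hℓ_avg, mul_one]
    show circleAverage (fun z => w z - a * ℓ z) c R = 0
    rw [circleAverage_fun_sub hi1 hi2, h2, ← ha, sub_self]
  have hest := abs_le_mul_norm_of_harmonicOnNhd_annulus hρ hρR hw'h hw'c hw'0 hw'K hw'avg
  intro z hz
  have h1 := hest z hz
  obtain ⟨hℓ0, hℓ1⟩ := hℓ_bounds z hz
  have h2 : |w z| ≤ |w' z| + |a| * ℓ z := by
    have : w z = w' z + a * ℓ z := by simp only [hw', sub_add_cancel]
    rw [this]
    calc |w' z + a * ℓ z| ≤ |w' z| + |a * ℓ z| := abs_add_le _ _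
      _ = |w' z| + |a| * ℓ z := by rw [abs_mul, abs_of_nonneg hℓ0]
  have h3 : |a| * ℓ z ≤ |a| := by
    have := mul_le_mul_of_nonneg_left hℓ1 (abs_nonneg a); rwa [mul_one] at this
  have h4 : 4 * (2 * K) * ‖z - c‖ / R = 8 * K * ‖z - c‖ / R := by ring
  rw [h4] at h1
  linarith

/-! ### §2 The dipole datum `Re (w/(z − c))` of an arbitrary direction `w` -/

/-- `Re (w/(z − c))` is harmonic off `c`. [folklore] -/
private theorem harmonicOnNhd_re_mul_inv_sub (w c : ℂ) :
    HarmonicOnNhd (fun z : ℂ => (w * (z - c)⁻¹).re) {c}ᶜ := by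
  intro z hz
  have han : AnalyticAt ℂ (fun z : ℂ => w * (z - c)⁻¹) z :=
    analyticAt_const.mul ((analyticAt_id.sub analyticAt_const).inv (sub_ne_zero.2 hz))
  exact han.harmonicAt_re

/-- `|Re (w/(z − c))| ≤ ‖w‖ · ‖z − c‖⁻¹`. [folklore] -/
private theorem abs_re_mul_inv_sub_le (w z c : ℂ) : |(w * (z - c)⁻¹).re| ≤ ‖w‖ * ‖z - c‖⁻¹ := by
  calc |(w * (z - c)⁻¹).re| ≤ ‖w * (z - c)⁻¹‖ := Complex.abs_re_le_norm _
    _ = ‖w‖ * ‖z - c‖⁻¹ := by rw [norm_mul, norm_inv]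

/-- The real part commutes with circle means of a function continuous on the circle. [folklore] -/
private theorem circleAverage_re_eq_re_circleAverage' {F : ℂ → ℂ} {t : ℝ}
    (hF : ContinuousOn F (sphere c |t|)) :
    circleAverage (fun z => (F z).re) c t = (circleAverage F c t).re := by
  have h := ContinuousLinearMap.circleAverage_comp_comm reCLM hF.circleIntegrable'
  rw [reCLM_apply] at h
  rw [← h]
  rfl

/-- **The dipole datum of direction `w` has zero mean on every circle about the pole**:
`⨍_{‖z−c‖=t} Re (w/(z − c)) = 0` (`∮ w (z − c)⁻² dz = 0`). [cite: Lin2011ClassicalComplexAnalysisII, §7.3.3 (7.3.3.3) proof, Step 1 (*7)]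
[folklore] -/
theorem circleAverage_re_mul_inv_sub (w c : ℂ) {t : ℝ} (ht : t ≠ 0) :
    circleAverage (fun z : ℂ => (w * (z - c)⁻¹).re) c t = 0 := by
  have hcont : ContinuousOn (fun z : ℂ => w * (z - c)⁻¹) (sphere c |t|) := by
    refine continuousOn_const.mul (ContinuousOn.inv₀ (continuousOn_id.sub continuousOn_const)
      fun z hz => ?_)
    rw [mem_sphere, dist_eq_norm] at hz
    rw [sub_ne_zero]; intro h; rw [h, sub_self, norm_zero] at hz
    exact ht (abs_eq_zero.1 hz.symm)
  rw [circleAverage_re_eq_re_circleAverage' hcont, circleAverage_eq_circleIntegral ht]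
  have hfun : (fun z : ℂ => (z - c)⁻¹ • (w * (z - c)⁻¹)) = fun z => w • (z - c) ^ (-2 : ℤ) := by
    funext z
    rw [smul_eq_mul, smul_eq_mul, zpow_neg, zpow_ofNat, ← inv_pow, pow_two]
    ring
  have hint : (∮ z in C(c, t), (z - c)⁻¹ • (w * (z - c)⁻¹)) = 0 := by
    rw [hfun, circleIntegral.integral_smul, circleIntegral.integral_sub_zpow_of_ne (by norm_num) c c t,
      smul_zero]
  rw [hint, smul_zero, Complex.zero_re]

/-- **Lin (7.3.3.3) Step 1, (*5)/(*12), for an arbitrary direction and WITHOUT zero flux.**  Let `u` be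
continuous on the closed annulus `ρ ≤ ‖z − c‖ ≤ R` (`0 < ρ < R`), harmonic inside, with the dipole boundary
values `u = Re (w/(z − c))` (`‖w‖ ≤ 1`) on the inner circle and `|u| ≤ M` on the outer circle.  Then
`|u(z) − Re (w/(z − c))| ≤ |⨍_{‖z−c‖=R} u| + 8(M + R⁻¹)‖z − c‖/R` on the closed annulus.
[cite: Lin2011ClassicalComplexAnalysisII, §7.3.3 (7.3.3.3) proof, Step 1 (*5)–(*12)] [folklore] -/
theorem abs_sub_re_mul_inv_le_of_harmonicOnNhd_annulus {u : ℂ → ℝ} {w : ℂ} {ρ M : ℝ} (hw : ‖w‖ ≤ 1)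
    (hρ : 0 < ρ) (hρR : ρ < R) (hu : HarmonicOnNhd u (ball c R \ closedBall c ρ))
    (huc : ContinuousOn u (closedBall c R \ ball c ρ))
    (hbd : ∀ z ∈ sphere c ρ, u z = (w * (z - c)⁻¹).re) (hM : ∀ z ∈ sphere c R, |u z| ≤ M) :
    ∀ z ∈ closedBall c R \ ball c ρ,
      |u z - (w * (z - c)⁻¹).re| ≤ |circleAverage u c R| + 8 * (M + R⁻¹) * ‖z - c‖ / R := by
  have hR : 0 < R := hρ.trans hρR
  have hAc : closedBall c R \ ball c ρ ⊆ ({c}ᶜ : Set ℂ) := by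
    intro z hz hzc
    rw [mem_singleton_iff] at hzc; subst hzc
    exact hz.2 (mem_ball_self hρ)
  have hUc : ball c R \ closedBall c ρ ⊆ ({c}ᶜ : Set ℂ) := fun z hz =>
    hAc ⟨ball_subset_closedBall hz.1, fun h => hz.2 (ball_subset_closedBall h)⟩
  have hd := harmonicOnNhd_re_mul_inv_sub w c
  have hW : HarmonicOnNhd (fun z => u z - (w * (z - c)⁻¹).re) (ball c R \ closedBall c ρ) :=
    hu.sub (hd.mono hUc)
  have hWc : ContinuousOn (fun z => u z - (w * (z - c)⁻¹).re) (closedBall c R \ ball c ρ) :=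
    huc.sub (hd.continuousOn.mono hAc)
  have h0 : ∀ z ∈ sphere c ρ, u z - (w * (z - c)⁻¹).re = 0 := fun z hz => by rw [hbd z hz, sub_self]
  have hK : ∀ z ∈ sphere c R, |u z - (w * (z - c)⁻¹).re| ≤ M + R⁻¹ := by
    intro z hz
    have hzR : ‖z - c‖ = R := by rwa [mem_sphere, dist_eq_norm] at hz
    have h1 : |(w * (z - c)⁻¹).re| ≤ R⁻¹ := by
      refine (abs_re_mul_inv_sub_le w z c).trans ?_
      rw [hzR]
      have := mul_le_mul_of_nonneg_right hw (inv_nonneg.2 hR.le)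
      rwa [one_mul] at this
    calc |u z - (w * (z - c)⁻¹).re| ≤ |u z| + |(w * (z - c)⁻¹).re| := abs_sub _ _
      _ ≤ M + R⁻¹ := add_le_add (hM z hz) h1
  have hSA : sphere c R ⊆ closedBall c R \ ball c ρ := fun z hz =>
    ⟨sphere_subset_closedBall hz, fun h => by
      rw [mem_ball] at h; rw [mem_sphere] at hz; rw [hz] at h; exact (lt_irrefl _) (h.trans hρR)⟩
  have havg : circleAverage (fun z => u z - (w * (z - c)⁻¹).re) c R = circleAverage u c R := by
    rw [circleAverage_fun_sub ((huc.mono hSA).circleIntegrable hR.le)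
      ((hd.continuousOn.mono (hSA.trans hAc)).circleIntegrable hR.le),
      circleAverage_re_mul_inv_sub w c hR.ne', sub_zero]
  have hest := abs_le_abs_circleAverage_add_of_harmonicOnNhd_annulus hρ hρR hW hWc h0 hK
  intro z hz
  have := hest z hz
  rw [havg] at this
  exact this

/-! ### §3 The bootstrap with a flux allowance (Lin's `C(r)`, FK (3.16.5)) -/

/-- **Uniform dipole estimate with a flux allowance.**  In the situation of
`abs_sub_re_mul_inv_le_of_harmonicOnNhd_annulus` suppose the outer bound `M` is attained or exceeded by
`|u|` on a circle `‖z − c‖ = r` with `ρ ≤ r`, `16 r ≤ R` (what the maximum principle on `R − D̄_r`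
gives for `M := max_{‖z−c‖=r} |u_ρ|`), and let `A ≥ |⨍_{‖z−c‖=R} u|`.  Then
`|u(z) − Re (w/(z − c))| ≤ A + 16(r⁻¹ + A + R⁻¹)‖z − c‖/R` on the closed annulus — free of `ρ` and `M`.
[cite: Lin2011ClassicalComplexAnalysisII, §7.3.3 (7.3.3.3) proof, Step 1 (*5)] [folklore] -/
theorem abs_sub_re_mul_inv_le_uniform_of_abs_circleAverage_le {u : ℂ → ℝ} {w : ℂ} {ρ r M A : ℝ}
    (hw : ‖w‖ ≤ 1) (hρ : 0 < ρ) (hρr : ρ ≤ r) (hrR : 16 * r ≤ R)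
    (hu : HarmonicOnNhd u (ball c R \ closedBall c ρ)) (huc : ContinuousOn u (closedBall c R \ ball c ρ))
    (hbd : ∀ z ∈ sphere c ρ, u z = (w * (z - c)⁻¹).re) (hM : ∀ z ∈ sphere c R, |u z| ≤ M)
    (hMr : ∃ z ∈ sphere c r, M ≤ |u z|) (hA : |circleAverage u c R| ≤ A) :
    ∀ z ∈ closedBall c R \ ball c ρ,
      |u z - (w * (z - c)⁻¹).re| ≤ A + 16 * (r⁻¹ + A + R⁻¹) * ‖z - c‖ / R := by
  have hr : 0 < r := hρ.trans_le hρr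
  have hρR : ρ < R := by linarith
  have hR : 0 < R := hρ.trans hρR
  have hRi : 0 < R⁻¹ := inv_pos.2 hR
  have hri : 0 < r⁻¹ := inv_pos.2 hr
  have hA0 : 0 ≤ A := (abs_nonneg _).trans hA
  have hest := abs_sub_re_mul_inv_le_of_harmonicOnNhd_annulus hw hρ hρR hu huc hbd hM
  -- the bootstrap inequality at a point of the small circle
  obtain ⟨z₀, hz₀, hMz₀⟩ := hMr
  have hz₀n : ‖z₀ - c‖ = r := by rwa [mem_sphere, dist_eq_norm] at hz₀
  have hz₀A : z₀ ∈ closedBall c R \ ball c ρ := by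
    simp only [Set.mem_sdiff, mem_closedBall, mem_ball, not_lt, dist_eq_norm, hz₀n]
    exact ⟨by linarith, hρr⟩
  have hboot : M ≤ r⁻¹ + A + 8 * (M + R⁻¹) * r / R := by
    have h1 := hest z₀ hz₀A
    rw [hz₀n] at h1
    have h2 : |u z₀| ≤ |(w * (z₀ - c)⁻¹).re| + |u z₀ - (w * (z₀ - c)⁻¹).re| := by
      have := abs_add_le ((w * (z₀ - c)⁻¹).re) (u z₀ - (w * (z₀ - c)⁻¹).re)
      rwa [add_sub_cancel] at this
    have h3 : |(w * (z₀ - c)⁻¹).re| ≤ r⁻¹ := by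
      refine (abs_re_mul_inv_sub_le w z₀ c).trans ?_
      rw [hz₀n]
      have := mul_le_mul_of_nonneg_right hw hri.le
      rwa [one_mul] at this
    linarith
  -- solve the bootstrap: `8 r / R ≤ 1/2`
  have hq : 8 * r / R ≤ 1 / 2 := by rw [div_le_iff₀ hR]; linarith
  have hq0 : 0 ≤ 8 * r / R := by positivity
  have hsplit : 8 * (M + R⁻¹) * r / R = 8 * r / R * M + 8 * r / R * R⁻¹ := by ring
  rw [hsplit] at hboot
  have hMle : M ≤ 2 * r⁻¹ + 2 * A + R⁻¹ := by
    by_cases hM0 : 0 ≤ M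
    · have h1 : 8 * r / R * M ≤ 1 / 2 * M := mul_le_mul_of_nonneg_right hq hM0
      have h2 : 8 * r / R * R⁻¹ ≤ 1 / 2 * R⁻¹ := mul_le_mul_of_nonneg_right hq hRi.le
      linarith
    · linarith
  have hcoef : 8 * (M + R⁻¹) ≤ 16 * (r⁻¹ + A + R⁻¹) := by linarith
  intro z hz
  refine (hest z hz).trans ?_
  have hzc : 0 ≤ ‖z - c‖ := norm_nonneg _
  have h1 : 8 * (M + R⁻¹) * ‖z - c‖ / R ≤ 16 * (r⁻¹ + A + R⁻¹) * ‖z - c‖ / R := by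
    rw [div_le_div_iff_of_pos_right hR]
    exact mul_le_mul_of_nonneg_right hcoef hzc
  linarith

/-! ### §4 Removability at the pole, arbitrary direction -/

/-- **Removable singularity of `u − Re (w/(z − c))` from a linear bound**, for an arbitrary direction `w`:
if `u` is harmonic on the punctured disc `0 < ‖z − c‖ < R` and `|u(z) − Re (w/(z − c))| ≤ C‖z − c‖`
there, then `u − Re (w/(z − c))` agrees on the punctured disc with a function `h` harmonic on the whole
disc with `h(c) = 0`. [cite: Lin2011ClassicalComplexAnalysisII, §7.3.3 (7.3.3.3) (2)(b), proof Step 3]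
[folklore] -/
theorem exists_harmonicOnNhd_eq_sub_re_mul_inv {u : ℂ → ℝ} {w : ℂ} {C : ℝ} (hR : 0 < R)
    (hu : HarmonicOnNhd u (ball c R \ {c}))
    (hC : ∀ z ∈ ball c R \ {c}, |u z - (w * (z - c)⁻¹).re| ≤ C * ‖z - c‖) :
    ∃ h : ℂ → ℝ, HarmonicOnNhd h (ball c R) ∧ h c = 0 ∧
      EqOn h (fun z => u z - (w * (z - c)⁻¹).re) (ball c R \ {c}) := by
  set W : ℂ → ℝ := fun z => u z - (w * (z - c)⁻¹).re with hW_def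
  have hPc : ball c R \ {c} ⊆ ({c}ᶜ : Set ℂ) := fun z hz => hz.2
  have hW : HarmonicOnNhd W (ball c R \ {c}) := hu.sub ((harmonicOnNhd_re_mul_inv_sub w c).mono hPc)
  have hWb : ∀ z ∈ ball c R \ {c}, |W z| ≤ C * R := by
    intro z hz
    have hzpos : 0 < ‖z - c‖ := norm_pos_iff.2 (sub_ne_zero.2 hz.2)
    have hzR : ‖z - c‖ < R := by rw [← dist_eq_norm]; exact mem_ball.1 hz.1
    have h1 := hC z hz
    have hC0 : 0 ≤ C := by
      by_contra hneg
      push Not at hneg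
      have : C * ‖z - c‖ < 0 := mul_neg_of_neg_of_pos hneg hzpos
      linarith [abs_nonneg (W z)]
    exact h1.trans (mul_le_mul_of_nonneg_left hzR.le hC0)
  obtain ⟨h, hh, hhW⟩ := exists_harmonicOnNhd_ball_eqOn_of_bounded hR (fun z hz => hW z hz) hWb
  refine ⟨h, hh, ?_, hhW⟩
  have hcont : ContinuousAt h c := (hh c (mem_ball_self hR)).1.continuousAt
  have hlim1 : Tendsto h (𝓝[≠] c) (𝓝 (h c)) := hcont.tendsto.mono_left nhdsWithin_le_nhds
  have hlim2 : Tendsto h (𝓝[≠] c) (𝓝 0) := by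
    have hbound : Tendsto (fun z : ℂ => C * ‖z - c‖) (𝓝[≠] c) (𝓝 0) := by
      have : Tendsto (fun z : ℂ => C * ‖z - c‖) (𝓝 c) (𝓝 (C * ‖c - c‖)) :=
        (continuous_const.mul (continuous_id.sub continuous_const).norm).continuousAt.tendsto
      rw [sub_self, norm_zero, mul_zero] at this
      exact this.mono_left nhdsWithin_le_nhds
    have hev : ∀ᶠ z in 𝓝[≠] c, ‖h z‖ ≤ C * ‖z - c‖ := by
      filter_upwards [sdiff_mem_nhdsWithin_compl (isOpen_ball.mem_nhds (mem_ball_self hR)) {c}]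
        with z hz
      rw [Real.norm_eq_abs, hhW hz]
      exact hC z hz
    exact squeeze_zero_norm' hev hbound
  exact tendsto_nhds_unique hlim1 hlim2

end Literature.Analysis.Complex

end
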